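import Summits.RiemannHypothesis.RiemannHypothesis.Theorems.ZetaStringArchWallHolds
import Summits.RiemannHypothesis.RiemannHypothesis.Theorems.WeilFormatCDataA1RungCB
import HarnessLib

/-!
# Kreĭn-kernel windows of `ζ`'s screw function from the certified Weil rung `a = 1` (column DBR; RH-FREE)

LINE 1 — LABEL: RH-FREE finite/structural facts (re-indexing of the tree's kernel-certified Weil rung
`WeilFormatCData.A1.weilPositivityOn_one : WeilPositivityOn 1` through the converse window dictionary of
`Theorems/ZetaStringKernelOfWeilOn.lean`). TAUTOLOGY LABEL: Weil positivity at depth `a = 1` in Suzuki's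
screw/Kreĭn coordinate; an RH-consequence-shaped statement certified RH-free at ONE depth, never evidence for
RH. bears_on: LADDER-RH B-D → B-P(P1) (cell rh-dbr: the one-sided window `ℓ = 2a = 2` is the range in which
the ET6 necessity depths `δ(N) ≥ 0`, `N ≤ 7`, are RH-free). WHAT THIS IS NOT: not progress toward RH; for
all windows the statement is RH (Suzuki 2023 Thm 1.2 / Weil's criterion).

* `isPosSemidefKernelOn_zetaScrewKernel_Ioo_neg_one_one` — `G = Ψ(t)+Ψ(u)−Ψ(t−u)` is positive semidefinite
  on finite configurations in `(−1, 1)` (`−Ψ|_{(−2,2)} ∈ 𝒢_1`, Suzuki 2023 (1.5));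
* `isPosSemidefKernelOn_zetaScrewKernel_Ioo_zero_two` — the same on the one-sided window `(0, 2)`;
* `sum_sum_mul_zetaScrew_nonpos_of_psd` — bookkeeping: PSD on `(−a, a)` ⟹ `Σ wᵢwⱼ Ψ(sᵢ − sⱼ) ≤ 0` for
  every zero-sum real system whose nodes have diameter `< 2a` (midpoint recentring);
* `sum_sum_mul_zetaScrew_nonpos_of_diam_lt_two` — **`Ψ` is conditionally negative definite on every
  zero-sum configuration of diameter `< 2`** (the normal form consumed by screw-side certificates: a
  failing vector of the explicit formula truncated below `N ≤ 7` cannot live inside a window shorter than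
  `log N`, since there the truncated and full forms agree).

References: M. Suzuki, J. Lond. Math. Soc. (2) 108 (2023) = arXiv:2206.03682, (1.4)–(1.5), Prop. 3.1;
A. Weil (1952); the tree's certificate `Theorems/WeilFormatCDataA1RungCB.lean`.
-/

-- `Summit.RiemannHypothesis.RiemannHypothesis.…` duplicates `RiemannHypothesis` BY DESIGN (D-0017).
set_option linter.dupNamespace false

noncomputable section

open scoped BigOperators

namespace Summit.RiemannHypothesis.RiemannHypothesis.Theorems.KernelOfWeilOn

open Literature.NumberTheory.LFunctions Literature.Analysis.Complex
open Summit.RiemannHypothesis.RiemannHypothesis.Theorems.ZetaStringArchWall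
  (isPosSemidefKernelOn_zetaScrewKernel_Ioo_zero_of_weilPositivityOn)

/-- RH-FREE: Suzuki's kernel `G = Ψ(t) + Ψ(u) − Ψ(t − u)` is positive semidefinite on finite configurations
in `(−1, 1)` — the tree's certified rung `WeilPositivityOn 1` through the converse window dictionary.
[cite: Suzuki2023, (1.5) and Prop 3.1] -/
theorem isPosSemidefKernelOn_zetaScrewKernel_Ioo_neg_one_one :
    IsPosSemidefKernelOn (fun t u : ℝ => (zetaScrewKernel t u : ℂ)) (Set.Ioo (-1) 1) :=
  isPosSemidefKernelOn_zetaScrewKernel_of_weilPositivityOn WeilFormatCData.A1.weilPositivityOn_one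

/-- RH-FREE: the same on the one-sided window `(0, 2)` (window `ℓ = 2a` ↔ half-width `a = 1`).
[cite: Suzuki2023, (1.5) and Prop 3.1] -/
theorem isPosSemidefKernelOn_zetaScrewKernel_Ioo_zero_two :
    IsPosSemidefKernelOn (fun t u : ℝ => (zetaScrewKernel t u : ℂ)) (Set.Ioo 0 2) := by
  have h := isPosSemidefKernelOn_zetaScrewKernel_Ioo_zero_of_weilPositivityOn
    WeilFormatCData.A1.weilPositivityOn_one
  have e : (2 : ℝ) * 1 = 2 := mul_one 2
  exact e ▸ h

/-- Bookkeeping (translation invariance of the zero-sum form): if `G` is positive semidefinite on `(−a, a)`,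
then `Σᵢⱼ wᵢ wⱼ Ψ(sᵢ − sⱼ) ≤ 0` for every finite real system with `Σ wᵢ = 0` whose nodes have diameter
`< 2a` (recentre at the midpoint of the range; the terms `Ψ(sᵢ)`, `Ψ(sⱼ)` of `G` drop out against zero-sum
weights). [folklore] -/
theorem sum_sum_mul_zetaScrew_nonpos_of_psd {a : ℝ}
    (h : IsPosSemidefKernelOn (fun t u : ℝ => (zetaScrewKernel t u : ℂ)) (Set.Ioo (-a) a))
    {N : ℕ} (s w : Fin N → ℝ) (hs : ∀ i j, s i - s j < 2 * a) (hw : ∑ i, w i = 0) :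
    ∑ i, ∑ j, w i * w j * zetaScrew (s i - s j) ≤ 0 := by
  rcases Nat.eq_zero_or_pos N with hN | hN
  · subst hN; simp
  rw [isPosSemidefKernelOn_zetaScrewKernel_iff] at h
  haveI : Nonempty (Fin N) := Fin.pos_iff_nonempty.1 hN
  have hne : (Finset.univ : Finset (Fin N)).Nonempty := Finset.univ_nonempty
  obtain ⟨iM, -, hiM⟩ := Finset.exists_mem_eq_sup' hne s
  obtain ⟨im, -, him⟩ := Finset.exists_mem_eq_inf' hne s
  set c : ℝ := (Finset.univ.sup' hne s + Finset.univ.inf' hne s) / 2 with hcdef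
  have hs' : ∀ i, s i - c ∈ Set.Ioo (-a) a := by
    intro i
    have h1 : s i ≤ Finset.univ.sup' hne s := Finset.le_sup' s (Finset.mem_univ i)
    have h2 : Finset.univ.inf' hne s ≤ s i := Finset.inf'_le s (Finset.mem_univ i)
    have h3 := hs iM im
    rw [← hiM, ← him] at h3
    constructor <;> linarith
  have key := h N (fun i => s i - c) w hs'
  have e2 : ∀ i j, zetaScrewKernel (s i - c) (s j - c) * (w i * w j) =
      w i * w j * zetaScrew (s i - c) + w i * w j * zetaScrew (s j - c)
        - w i * w j * zetaScrew (s i - s j) := by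
    intro i j
    rw [zetaScrewKernel, sub_sub_sub_cancel_right]
    ring
  simp only [e2, Finset.sum_add_distrib, Finset.sum_sub_distrib,
    Suzuki2023Thm42.sum_sum_mul_mul_eq_zero_left w hw (fun i => zetaScrew (s i - c)),
    Suzuki2023Thm42.sum_sum_mul_mul_eq_zero_right w hw (fun j => zetaScrew (s j - c))] at key
  linarith

/-- **RH-FREE: `Ψ` is conditionally negative definite on every zero-sum configuration of diameter `< 2`** —
`Σᵢⱼ wᵢ wⱼ Ψ(sᵢ − sⱼ) ≤ 0` whenever `Σ wᵢ = 0` and all `sᵢ − sⱼ < 2` (Weil rung `a = 1` re-indexed; for every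
diameter this is RH). [cite: Suzuki2023, (1.5), Thm 1.2 and Prop 3.1] -/
theorem sum_sum_mul_zetaScrew_nonpos_of_diam_lt_two {N : ℕ} (s w : Fin N → ℝ)
    (hs : ∀ i j, s i - s j < 2) (hw : ∑ i, w i = 0) :
    ∑ i, ∑ j, w i * w j * zetaScrew (s i - s j) ≤ 0 :=
  sum_sum_mul_zetaScrew_nonpos_of_psd isPosSemidefKernelOn_zetaScrewKernel_Ioo_neg_one_one s w
    (fun i j => by simpa using hs i j) hw

end Summit.RiemannHypothesis.RiemannHypothesis.Theorems.KernelOfWeilOn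

end
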